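import Literature.Computability.AlgebraicComplexity.HrubesSensitiveMonotoneProofs
import Literature.Computability.AlgebraicComplexity.SyntacticMultilinear
import HarnessLib

/-!
# Growing a syntactically multilinear gate list (Raz–Yehudayoff 2008, §2) — plumbing

Theorem-only support file for the tree's circuit model `ArithCircuit` (`ArithCircuit.lean`) and the
fact-free predicate `IsSyntacticallyMultilinear` (`SyntacticMultilinear.lean`, Raz–Yehudayoff 2008
§2: "for every product gate `v` with sons `v₁, v₂`, `X_{v₁} ∩ X_{v₂} = ∅`", `X_v` the set of
variables occurring in the subcircuit of `v`).

Constructions of concrete syntactically multilinear circuits with SHARING (tables of partial results,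
gate-by-gate transformations of a given circuit) are most conveniently carried out in the "growing
gate list" discipline of `HrubesSensitiveMonotoneProofs.lean` / `HomogeneousComponentsComplexity.lean`
(Bürgisser–Clausen–Shokrollahi (21.25)): the program is only ever extended AT THE END, a computed
polynomial is "available" through an operand referring below the current length, and availability
persists under extension. This file adds the SYNTACTIC side of that bookkeeping: the syntactic
variable set `operandVarSet (gateVarSets gs) u` of an available operand is likewise stable under
extension (`operandVarSet_of_prefix`), appending a SUM gate never breaks syntactic multilinearity
(`isSyntacticallyMultilinear_append_sum`), and appending a PRODUCT gate `u · w` keeps it provided the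
syntactic variable sets of `u` and `w` are disjoint (`isSyntacticallyMultilinear_append_prod₂`);
together with the value / variable-set / fan-in of the appended gate read through the fresh operand
`Operand.gate gs.length` (`eval_gate_length_append`, `operandVarSet_gate_length_append`,
`gateVarSet_prod₂`, …). The value-side lemmas (`Hrubes2020.operand_eval_of_prefix`,
`Hrubes2020.refsBelow_mono`, …) are REUSED from `HrubesSensitiveMonotoneProofs.lean`, not restated;
the one fold lemma for `gateVarSets` is `gateVarSets_append_singleton_and_length` (the copies in
`FullRankMultilinearCircuit.lean` concern the barrier namespace's duplicate of `gateVarSets` and do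
not apply to the fact-free predicate). No definitions: the predicate is applied to the circuit
`⟨gs, Operand.gate 0⟩` (it only reads the gate list, `isSyntacticallyMultilinear_iff_gates`).

Consumers: the tripartition bridge of route `ValiantsHypothesis/RyserTripartition`
(`Summits/…/Theorems/RyserTripartitionPerLeTripartition*.lean`).

## References

* [RazYehudayoff2008] R. Raz, A. Yehudayoff, *Balancing syntactically multilinear arithmetic
  circuits*, Comput. Complexity 17 (2008), §2.
* [Burgisser2000] P. Bürgisser, *Completeness and Reduction in Algebraic Complexity Theory*,
  Def. 2.1 (the straight-line model).
-/

noncomputable section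

namespace Literature.Computability.AlgebraicComplexity

open MvPolynomial ArithCircuit

namespace SmAppend

universe u v

variable {k : Type u} {σ : Type v}

/-! ### Syntactic variable sets under extension of the gate list -/

section VarSets

variable [DecidableEq σ]

/-- The left fold `gateVarSets`: one step, and one entry per gate. [cite: RazYehudayoff2008, §2] -/
theorem gateVarSets_append_singleton_and_length (gs : List (Gate k σ)) :
    (∀ g : Gate k σ, gateVarSets (gs ++ [g]) = gateVarSets gs ++ [gateVarSet (gateVarSets gs) g]) ∧
      (gateVarSets gs).length = gs.length := by
  have step : ∀ (gs : List (Gate k σ)) (g : Gate k σ),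
      gateVarSets (gs ++ [g]) = gateVarSets gs ++ [gateVarSet (gateVarSets gs) g] := fun gs g => by
    simp [gateVarSets, List.foldl_append]
  refine ⟨step gs, ?_⟩
  induction gs using List.reverseRecOn with
  | nil => rfl
  | append_singleton gs g ih => simp [step, ih]

/-- The variable-set list of a prefix is a prefix of the variable-set list. [cite: RazYehudayoff2008, §2] -/
theorem gateVarSets_prefix {gs gs' : List (Gate k σ)} (h : gs <+: gs') :
    gateVarSets gs <+: gateVarSets gs' := by
  obtain ⟨t, rfl⟩ := h
  induction t using List.reverseRecOn with
  | nil => simp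
  | append_singleton t g ih =>
    rw [← List.append_assoc, (gateVarSets_append_singleton_and_length _).1]
    exact ih.trans (List.prefix_append _ _)

omit [DecidableEq σ] in
/-- An operand referring below `vs.length` ignores appended variable sets. [cite: RazYehudayoff2008, §2] -/
theorem operandVarSet_append {vs ws : List (Finset σ)} {u : Operand k σ}
    (hu : u.RefsBelow vs.length) : operandVarSet (vs ++ ws) u = operandVarSet vs u := by
  cases u with
  | var i => rfl
  | const c => rfl
  | gate j =>
    simp only [Operand.RefsBelow] at hu
    simp [operandVarSet, List.getD_eq_getElem?_getD, List.getElem?_append_left hu]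

/-- An operand referring to gates of `gs` keeps its syntactic variable set when `gs` is extended.
[cite: RazYehudayoff2008, §2] -/
theorem operandVarSet_of_prefix {gs gs' : List (Gate k σ)} (h : gs <+: gs') {u : Operand k σ}
    (hu : u.RefsBelow gs.length) :
    operandVarSet (gateVarSets gs') u = operandVarSet (gateVarSets gs) u := by
  obtain ⟨t, ht⟩ := gateVarSets_prefix h
  rw [← ht]
  apply operandVarSet_append
  rwa [(gateVarSets_append_singleton_and_length gs).2]

/-- The fresh operand `gate gs.length` reads the variable set of the appended gate.
[cite: RazYehudayoff2008, §2] -/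
theorem operandVarSet_gate_length_append (gs : List (Gate k σ)) (g : Gate k σ) :
    operandVarSet (gateVarSets (gs ++ [g])) (Operand.gate gs.length : Operand k σ) =
      gateVarSet (gateVarSets gs) g := by
  obtain ⟨hstep, hl⟩ := gateVarSets_append_singleton_and_length (k := k) gs
  rw [hstep]
  simp only [operandVarSet, List.getD_eq_getElem?_getD]
  rw [List.getElem?_append_right (by rw [hl])]
  simp [hl]

/-- Variable set of a binary weighted-sum gate. [cite: RazYehudayoff2008, §2] -/
theorem gateVarSet_sum₂ (vs : List (Finset σ)) (a b : k) (u w : Operand k σ) :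
    gateVarSet vs (Gate.sum [(a, u), (b, w)]) = operandVarSet vs u ∪ operandVarSet vs w := by
  simp [gateVarSet, Gate.args]

/-- Variable set of a unary weighted-sum gate. [cite: RazYehudayoff2008, §2] -/
theorem gateVarSet_sum₁ (vs : List (Finset σ)) (a : k) (u : Operand k σ) :
    gateVarSet vs (Gate.sum [(a, u)]) = operandVarSet vs u := by
  simp [gateVarSet, Gate.args]

/-- Variable set of a binary product gate. [cite: RazYehudayoff2008, §2] -/
theorem gateVarSet_prod₂ (vs : List (Finset σ)) (u w : Operand k σ) :
    gateVarSet vs (Gate.prod [u, w]) = operandVarSet vs u ∪ operandVarSet vs w := by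
  simp [gateVarSet, Gate.args]

omit [DecidableEq σ] in
/-- The variable set of a variable operand. [cite: RazYehudayoff2008, §2] -/
@[simp] theorem operandVarSet_var (vs : List (Finset σ)) (i : σ) :
    operandVarSet vs (Operand.var i : Operand k σ) = {i} := rfl

omit [DecidableEq σ] in
/-- The variable set of a constant operand. [cite: RazYehudayoff2008, §2] -/
@[simp] theorem operandVarSet_const (vs : List (Finset σ)) (c : k) :
    operandVarSet vs (Operand.const c : Operand k σ) = ∅ := rfl

end VarSets

/-! ### Fan-in and reference bookkeeping -/

section FanIn

/-- `RefsBelow` persists under extension of the gate list. [cite: Burgisser2000, Def. 2.1] -/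
theorem refsBelow_of_prefix {gs gs' : List (Gate k σ)} (h : gs <+: gs') {u : Operand k σ}
    (hu : u.RefsBelow gs.length) : u.RefsBelow gs'.length :=
  Hrubes2020.refsBelow_mono h.length_le hu

/-- The fresh operand `gate gs.length` refers below the length of `gs ++ [g]`.
[cite: Burgisser2000, Def. 2.1] -/
theorem refsBelow_gate_length_append (gs : List (Gate k σ)) (g : Gate k σ) :
    (Operand.gate gs.length : Operand k σ).RefsBelow (gs ++ [g]).length := by
  simp [Operand.RefsBelow]

/-- Appending a gate of fan-in `≤ 2` keeps the fan-in-two property of a gate list.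
[cite: Burgisser2000, Def. 2.1] -/
theorem fanIn_append {gs : List (Gate k σ)} (hgs : ∀ g ∈ gs, g.fanIn ≤ 2) {g : Gate k σ}
    (hg : g.fanIn ≤ 2) : ∀ g' ∈ gs ++ [g], g'.fanIn ≤ 2 := by
  intro g' hg'
  rw [List.mem_append, List.mem_singleton] at hg'
  rcases hg' with hg' | rfl
  · exact hgs g' hg'
  · exact hg

/-- A binary sum gate has fan-in `2`. [cite: Burgisser2000, Def. 2.1] -/
@[simp] theorem fanIn_sum₂ (a b : k) (u w : Operand k σ) :
    (Gate.sum [(a, u), (b, w)]).fanIn = 2 := rfl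

/-- A unary sum gate has fan-in `1`. [cite: Burgisser2000, Def. 2.1] -/
@[simp] theorem fanIn_sum₁ (a : k) (u : Operand k σ) : (Gate.sum [(a, u)]).fanIn = 1 := rfl

/-- A binary product gate has fan-in `2`. [cite: Burgisser2000, Def. 2.1] -/
@[simp] theorem fanIn_prod₂ (u w : Operand k σ) : (Gate.prod [u, w]).fanIn = 2 := rfl

end FanIn

/-! ### Syntactic multilinearity of a gate list under extension -/

section Sm

variable [DecidableEq σ]

/-- `IsSyntacticallyMultilinear` only reads the gate list: the circuits `⟨gs, out⟩` and `⟨gs, out'⟩`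
are syntactically multilinear together. [cite: RazYehudayoff2008, §2] -/
theorem isSyntacticallyMultilinear_iff_gates (gs : List (Gate k σ)) (out out' : Operand k σ) :
    IsSyntacticallyMultilinear (⟨gs, out⟩ : ArithCircuit k σ) ↔
      IsSyntacticallyMultilinear (⟨gs, out'⟩ : ArithCircuit k σ) :=
  Iff.rfl

/-- The empty gate list is syntactically multilinear. [cite: RazYehudayoff2008, §2] -/
theorem isSyntacticallyMultilinear_nil (out : Operand k σ) :
    IsSyntacticallyMultilinear (⟨[], out⟩ : ArithCircuit k σ) :=
  isSyntacticallyMultilinear_of_gates_eq_nil rfl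

/-- Appending a gate whose operands (if it is a product gate) have pairwise disjoint syntactic
variable sets with respect to the CURRENT list keeps syntactic multilinearity.
[cite: RazYehudayoff2008, §2] -/
theorem isSyntacticallyMultilinear_append {gs : List (Gate k σ)} {out : Operand k σ}
    (hgs : IsSyntacticallyMultilinear (⟨gs, out⟩ : ArithCircuit k σ)) (g : Gate k σ)
    (hg : ∀ args : List (Operand k σ), g = Gate.prod args →
      (args.map (operandVarSet (gateVarSets gs))).Pairwise Disjoint) :
    IsSyntacticallyMultilinear (⟨gs ++ [g], out⟩ : ArithCircuit k σ) := by
  intro i args hi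
  change (gs ++ [g])[i]? = some (Gate.prod args) at hi
  by_cases hlt : i < gs.length
  · rw [List.getElem?_append_left hlt] at hi
    have htake : (gs ++ [g]).take i = gs.take i := List.take_append_of_le_length hlt.le
    change (args.map (operandVarSet (gateVarSets ((gs ++ [g]).take i)))).Pairwise Disjoint
    rw [htake]
    exact hgs i args hi
  · have hge : gs.length ≤ i := Nat.le_of_not_lt hlt
    rw [List.getElem?_append_right hge] at hi
    have hi0 : i - gs.length = 0 := by
      rcases Nat.eq_zero_or_pos (i - gs.length) with h0 | hpos
      · exact h0
      · exfalso
        have : ([g] : List (Gate k σ))[i - gs.length]? = none :=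
          List.getElem?_eq_none_iff.mpr (by simp; omega)
        rw [this] at hi
        cases hi
    rw [hi0] at hi
    simp only [List.getElem?_cons_zero, Option.some.injEq] at hi
    have hi' : i = gs.length := by omega
    have htake : (gs ++ [g]).take i = gs := by
      rw [hi']; exact List.take_left' rfl
    change (args.map (operandVarSet (gateVarSets ((gs ++ [g]).take i)))).Pairwise Disjoint
    rw [htake]
    exact hg args hi

/-- Appending a SUM gate keeps syntactic multilinearity (sum gates are unconstrained).
[cite: RazYehudayoff2008, §2] -/
theorem isSyntacticallyMultilinear_append_sum {gs : List (Gate k σ)} {out : Operand k σ}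
    (hgs : IsSyntacticallyMultilinear (⟨gs, out⟩ : ArithCircuit k σ))
    (args : List (k × Operand k σ)) :
    IsSyntacticallyMultilinear (⟨gs ++ [Gate.sum args], out⟩ : ArithCircuit k σ) :=
  isSyntacticallyMultilinear_append hgs _ fun _ h => by cases h

/-- Appending a binary PRODUCT gate `u · w` keeps syntactic multilinearity when the syntactic
variable sets of `u` and `w` (bounded by `V` and `W`) are disjoint. [cite: RazYehudayoff2008, §2] -/
theorem isSyntacticallyMultilinear_append_prod₂ {gs : List (Gate k σ)} {out : Operand k σ}
    (hgs : IsSyntacticallyMultilinear (⟨gs, out⟩ : ArithCircuit k σ)) {u w : Operand k σ}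
    {V W : Finset σ} (hu : operandVarSet (gateVarSets gs) u ⊆ V)
    (hw : operandVarSet (gateVarSets gs) w ⊆ W) (hVW : Disjoint V W) :
    IsSyntacticallyMultilinear (⟨gs ++ [Gate.prod [u, w]], out⟩ : ArithCircuit k σ) := by
  refine isSyntacticallyMultilinear_append hgs _ fun args h => ?_
  simp only [Gate.prod.injEq] at h
  subst h
  simp only [List.map_cons, List.map_nil, List.pairwise_cons, List.mem_singleton, forall_eq,
    List.not_mem_nil, IsEmpty.forall_iff, implies_true, List.Pairwise.nil, and_true]
  exact hVW.mono hu hw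

end Sm

/-! ### Values of appended gates

(Stability of the value of an old operand under extension is `Hrubes2020.operand_eval_of_prefix`.) -/

section Values

variable [CommSemiring k]

/-- The fresh operand `gate gs.length` reads the value of the appended gate.
[cite: Burgisser2000, Def. 2.1] -/
theorem eval_gate_length_append (gs : List (Gate k σ)) (g : Gate k σ) :
    (Operand.gate gs.length : Operand k σ).eval (gateValues (gs ++ [g])) =
      g.eval (gateValues gs) := by
  rw [gateValues_append_singleton]
  simp only [Operand.eval, List.getD_eq_getElem?_getD]
  rw [List.getElem?_append_right (by rw [gateValues_length])]
  simp [gateValues_length]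

end Values

/-! ### Packaged extension steps

Each step appends ONE gate to a fan-in-two syntactically multilinear gate list and returns the fresh
operand with its value and a bound on its syntactic variable set. -/

section Steps

variable [CommSemiring k] [DecidableEq σ]

/-- **Sum step.** Appending `a • u + b • w`: the list stays fan-in-two and syntactically
multilinear; the fresh operand has value `a • ⟦u⟧ + b • ⟦w⟧` and variable set `X_u ∪ X_w`.
[cite: RazYehudayoff2008, §2] -/
theorem step_sum₂ {gs : List (Gate k σ)} (h2 : ∀ g ∈ gs, g.fanIn ≤ 2)
    (hsm : IsSyntacticallyMultilinear (⟨gs, Operand.gate 0⟩ : ArithCircuit k σ))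
    (a b : k) {u w : Operand k σ}
    {V W : Finset σ} (huV : operandVarSet (gateVarSets gs) u ⊆ V)
    (hwW : operandVarSet (gateVarSets gs) w ⊆ W) :
    (∀ g ∈ gs ++ [Gate.sum [(a, u), (b, w)]], g.fanIn ≤ 2) ∧
    IsSyntacticallyMultilinear (⟨gs ++ [Gate.sum [(a, u), (b, w)]], Operand.gate 0⟩ : ArithCircuit k σ) ∧
    (Operand.gate gs.length : Operand k σ).RefsBelow (gs ++ [Gate.sum [(a, u), (b, w)]]).length ∧
    (Operand.gate gs.length : Operand k σ).eval (gateValues (gs ++ [Gate.sum [(a, u), (b, w)]])) =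
      a • u.eval (gateValues gs) + b • w.eval (gateValues gs) ∧
    operandVarSet (gateVarSets (gs ++ [Gate.sum [(a, u), (b, w)]])) (Operand.gate gs.length : Operand k σ)
      ⊆ V ∪ W := by
  refine ⟨fanIn_append h2 (by simp), isSyntacticallyMultilinear_append_sum hsm _,
    refsBelow_gate_length_append gs _, ?_, ?_⟩
  · rw [eval_gate_length_append]; simp [Gate.eval]
  · rw [operandVarSet_gate_length_append, gateVarSet_sum₂]
    exact Finset.union_subset_union huV hwW

/-- **Unary sum step.** Appending `a • u`. [cite: RazYehudayoff2008, §2] -/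
theorem step_sum₁ {gs : List (Gate k σ)} (h2 : ∀ g ∈ gs, g.fanIn ≤ 2)
    (hsm : IsSyntacticallyMultilinear (⟨gs, Operand.gate 0⟩ : ArithCircuit k σ))
    (a : k) {u : Operand k σ}
    {V : Finset σ} (huV : operandVarSet (gateVarSets gs) u ⊆ V) :
    (∀ g ∈ gs ++ [Gate.sum [(a, u)]], g.fanIn ≤ 2) ∧
    IsSyntacticallyMultilinear (⟨gs ++ [Gate.sum [(a, u)]], Operand.gate 0⟩ : ArithCircuit k σ) ∧
    (Operand.gate gs.length : Operand k σ).RefsBelow (gs ++ [Gate.sum [(a, u)]]).length ∧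
    (Operand.gate gs.length : Operand k σ).eval (gateValues (gs ++ [Gate.sum [(a, u)]])) =
      a • u.eval (gateValues gs) ∧
    operandVarSet (gateVarSets (gs ++ [Gate.sum [(a, u)]])) (Operand.gate gs.length : Operand k σ)
      ⊆ V := by
  refine ⟨fanIn_append h2 (by simp), isSyntacticallyMultilinear_append_sum hsm _,
    refsBelow_gate_length_append gs _, ?_, ?_⟩
  · rw [eval_gate_length_append]; simp [Gate.eval]
  · rw [operandVarSet_gate_length_append, gateVarSet_sum₁]
    exact huV

/-- **Product step.** Appending `u · w` with DISJOINT variable-set bounds `V`, `W`: the list stays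
fan-in-two and syntactically multilinear; the fresh operand has value `⟦u⟧ · ⟦w⟧` and variable set
`⊆ V ∪ W`. [cite: RazYehudayoff2008, §2] -/
theorem step_prod₂ {gs : List (Gate k σ)} (h2 : ∀ g ∈ gs, g.fanIn ≤ 2)
    (hsm : IsSyntacticallyMultilinear (⟨gs, Operand.gate 0⟩ : ArithCircuit k σ))
    {u w : Operand k σ}
    {V W : Finset σ} (huV : operandVarSet (gateVarSets gs) u ⊆ V)
    (hwW : operandVarSet (gateVarSets gs) w ⊆ W) (hVW : Disjoint V W) :
    (∀ g ∈ gs ++ [Gate.prod [u, w]], g.fanIn ≤ 2) ∧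
    IsSyntacticallyMultilinear (⟨gs ++ [Gate.prod [u, w]], Operand.gate 0⟩ : ArithCircuit k σ) ∧
    (Operand.gate gs.length : Operand k σ).RefsBelow (gs ++ [Gate.prod [u, w]]).length ∧
    (Operand.gate gs.length : Operand k σ).eval (gateValues (gs ++ [Gate.prod [u, w]])) =
      u.eval (gateValues gs) * w.eval (gateValues gs) ∧
    operandVarSet (gateVarSets (gs ++ [Gate.prod [u, w]])) (Operand.gate gs.length : Operand k σ)
      ⊆ V ∪ W := by
  refine ⟨fanIn_append h2 (by simp), isSyntacticallyMultilinear_append_prod₂ hsm huV hwW hVW,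
    refsBelow_gate_length_append gs _, ?_, ?_⟩
  · rw [eval_gate_length_append]; simp [Gate.eval]
  · rw [operandVarSet_gate_length_append, gateVarSet_prod₂]
    exact Finset.union_subset_union huV hwW

end Steps

end SmAppend

end Literature.Computability.AlgebraicComplexity

end
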